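import Literature.Topology.FourManifolds.PlanarArch
import HarnessLib

/-!
# The explicit planar arch

Topic `Literature/Topology/FourManifolds` (trunk T-4MAN). Companion of `PlanarArch.lean`: the
curve produced by `Literature.Topology.FourManifolds.exists_planarArch` (the planar arch with
prescribed ends used to rebuild knots along a band, `BandRebuildArches.lean`, `BandCore.lean`) is
the explicit map

  `planarArch θ₁ θ₂ ε f g θ = (χ₁ θ, (1 - χ₂ θ) f θ + χ₂ θ g θ)`,

`χ₁ = smoothStep (θ₁ + ε) (θ₂ - ε)`, `χ₂ = smoothStep (θ₁ + 2ε) (θ₂ - 2ε)`. This file names it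
(`Literature.Topology.FourManifolds.planarArch`) and proves for it, verbatim, the eight properties
of `exists_planarArch` (`planarArch_spec`), together with the structure that the existential
statement hides and that the handle-slide programme needs (fact seat
`provefact-IsStrictHandleSlide.isSurgery`, Kirby (1989), Ch. I §4: the rebuilt attaching circle
must be deformed by explicit planar families near the band end): the coordinate formulas
(`planarArch_apply_zero`, `planarArch_apply_one`) and the strict monotonicity of the first
coordinate across the arch (`strictMonoOn_planarArch_fst`, `monotone_planarArch_fst`).
Everything is proved; the only new declaration besides theorems is the real-analytic-free
definition `planarArch` (no named facts).

## References

Standard real analysis; `[folklore]`. R. C. Kirby, *The Topology of 4-Manifolds*, LNM 1374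
(1989), Ch. I §4 (context only). [Kirby1989]
-/

open scoped ContDiff Topology
open Function Set Real

noncomputable section

namespace Literature.Topology.FourManifolds

/-- **The explicit planar arch** `θ ↦ (χ₁ θ, (1 - χ₂ θ) f θ + χ₂ θ g θ)` with the nested smooth
steps `χ₁ = smoothStep (θ₁ + ε) (θ₂ - ε)`, `χ₂ = smoothStep (θ₁ + 2ε) (θ₂ - 2ε)`: the witness of
`exists_planarArch`. [folklore] -/
def planarArch (θ₁ θ₂ ε : ℝ) (f g : ℝ → ℝ) (θ : ℝ) : EuclideanSpace ℝ (Fin 2) :=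
  pt2 (smoothStep (θ₁ + ε) (θ₂ - ε) θ)
    ((1 - smoothStep (θ₁ + 2 * ε) (θ₂ - 2 * ε) θ) * f θ + smoothStep (θ₁ + 2 * ε) (θ₂ - 2 * ε) θ * g θ)

section PlanarArch

variable {θ₁ θ₂ ε : ℝ} {f g : ℝ → ℝ}

/-- First coordinate of the explicit arch: the outer smooth step. [folklore] -/
@[simp] theorem planarArch_apply_zero (θ : ℝ) :
    planarArch θ₁ θ₂ ε f g θ 0 = smoothStep (θ₁ + ε) (θ₂ - ε) θ := rfl

/-- Second coordinate of the explicit arch: the blend of `f` and `g` along the inner smooth step.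
[folklore] -/
@[simp] theorem planarArch_apply_one (θ : ℝ) :
    planarArch θ₁ θ₂ ε f g θ 1 =
      (1 - smoothStep (θ₁ + 2 * ε) (θ₂ - 2 * ε) θ) * f θ +
        smoothStep (θ₁ + 2 * ε) (θ₂ - 2 * ε) θ * g θ := rfl

/-- **The first coordinate of the arch is strictly increasing across the arch**
(on `[θ₁ + ε, θ₂ - ε]`, for `θ₁ + ε < θ₂ - ε`). [folklore] -/
theorem strictMonoOn_planarArch_fst (h : θ₁ + ε < θ₂ - ε) :
    StrictMonoOn (fun θ ↦ planarArch θ₁ θ₂ ε f g θ 0) (Icc (θ₁ + ε) (θ₂ - ε)) := by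
  simpa only [planarArch_apply_zero] using strictMonoOn_smoothStep h

/-- The first coordinate of the arch is monotone on the whole line (for `θ₁ + ε ≤ θ₂ - ε`).
[folklore] -/
theorem monotone_planarArch_fst (h : θ₁ + ε ≤ θ₂ - ε) :
    Monotone fun θ ↦ planarArch θ₁ θ₂ ε f g θ 0 := by
  simpa only [planarArch_apply_zero] using monotone_smoothStep h

/-- **The explicit arch has the eight properties of `exists_planarArch`** (same hypotheses, same
proof): `C^∞`; `(0, f θ)` for `θ ≤ θ₁ + ε`; `(1, g θ)` for `θ ≥ θ₂ - ε`; first coordinate in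
`(0, 1)` strictly in between and in `[0, 1]` always; second coordinate between `f θ` and `g θ`;
injective; regular. [folklore] -/
theorem planarArch_spec (hε : 0 < ε) (hθ : θ₁ + 2 * ε < θ₂ - 2 * ε)
    (hf : ContDiff ℝ ∞ f) (hg : ContDiff ℝ ∞ g)
    (hf' : ∀ θ, θ ≤ θ₁ + 2 * ε → 0 < deriv f θ)
    (hg' : ∀ θ, θ₂ - 2 * ε ≤ θ → deriv g θ < 0) :
    ContDiff ℝ ∞ (planarArch θ₁ θ₂ ε f g) ∧
      (∀ θ, θ ≤ θ₁ + ε → planarArch θ₁ θ₂ ε f g θ = pt2 0 (f θ)) ∧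
      (∀ θ, θ₂ - ε ≤ θ → planarArch θ₁ θ₂ ε f g θ = pt2 1 (g θ)) ∧
      (∀ θ ∈ Ioo (θ₁ + ε) (θ₂ - ε), planarArch θ₁ θ₂ ε f g θ 0 ∈ Ioo (0 : ℝ) 1) ∧
      (∀ θ, planarArch θ₁ θ₂ ε f g θ 0 ∈ Icc (0 : ℝ) 1) ∧
      (∀ θ, planarArch θ₁ θ₂ ε f g θ 1 ∈ uIcc (f θ) (g θ)) ∧
      Injective (planarArch θ₁ θ₂ ε f g) ∧
      ∀ θ, deriv (planarArch θ₁ θ₂ ε f g) θ ≠ 0 := by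
  have h1 : θ₁ + ε < θ₂ - ε := by linarith
  have h2 : θ₁ + 2 * ε < θ₂ - 2 * ε := hθ
  set χ₁ := smoothStep (θ₁ + ε) (θ₂ - ε) with hχ₁
  set χ₂ := smoothStep (θ₁ + 2 * ε) (θ₂ - 2 * ε) with hχ₂
  set v : ℝ → ℝ := fun θ ↦ (1 - χ₂ θ) * f θ + χ₂ θ * g θ with hv
  set c : ℝ → EuclideanSpace ℝ (Fin 2) := planarArch θ₁ θ₂ ε f g with hc
  have hcθ : ∀ θ, c θ = pt2 (χ₁ θ) (v θ) := fun θ ↦ rfl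
  have hc0 : ∀ θ, c θ 0 = χ₁ θ := fun θ ↦ rfl
  have hc1 : ∀ θ, c θ 1 = v θ := fun θ ↦ rfl
  -- smoothness
  have hχ₁s : ContDiff ℝ ∞ χ₁ := contDiff_smoothStep _ _
  have hχ₂s : ContDiff ℝ ∞ χ₂ := contDiff_smoothStep _ _
  have hvs : ContDiff ℝ ∞ v := ((contDiff_const.sub hχ₂s).mul hf).add (hχ₂s.mul hg)
  have hcs : ContDiff ℝ ∞ c := by
    rw [contDiff_euclidean]
    intro i
    fin_cases i
    · exact hχ₁s
    · exact hvs
  -- values of the steps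
  have hχ₂0 : ∀ θ, θ ≤ θ₁ + 2 * ε → χ₂ θ = 0 := fun θ hθ' ↦ smoothStep_of_le h2 hθ'
  have hχ₂1 : ∀ θ, θ₂ - 2 * ε ≤ θ → χ₂ θ = 1 := fun θ hθ' ↦ smoothStep_of_ge h2 hθ'
  have hχ₁0 : ∀ θ, θ ≤ θ₁ + ε → χ₁ θ = 0 := fun θ hθ' ↦ smoothStep_of_le h1 hθ'
  have hχ₁1 : ∀ θ, θ₂ - ε ≤ θ → χ₁ θ = 1 := fun θ hθ' ↦ smoothStep_of_ge h1 hθ'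
  have hvf : ∀ θ, θ ≤ θ₁ + 2 * ε → v θ = f θ := fun θ hθ' ↦ by
    simp only [hv, hχ₂0 θ hθ']; ring
  have hvg : ∀ θ, θ₂ - 2 * ε ≤ θ → v θ = g θ := fun θ hθ' ↦ by
    simp only [hv, hχ₂1 θ hθ']; ring
  -- the two end formulas
  have hleft : ∀ θ, θ ≤ θ₁ + ε → c θ = pt2 0 (f θ) := fun θ hθ' ↦ by
    rw [hcθ, hχ₁0 θ hθ', hvf θ (by linarith)]
  have hright : ∀ θ, θ₂ - ε ≤ θ → c θ = pt2 1 (g θ) := fun θ hθ' ↦ by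
    rw [hcθ, hχ₁1 θ hθ', hvg θ (by linarith)]
  -- monotonicity of the pieces
  have hfm : StrictMonoOn f (Iic (θ₁ + 2 * ε)) := by
    refine strictMonoOn_of_deriv_pos (convex_Iic _) hf.continuous.continuousOn fun x hx ↦ ?_
    rw [interior_Iic] at hx
    exact hf' x (le_of_lt hx)
  have hgm : StrictAntiOn g (Ici (θ₂ - 2 * ε)) := by
    refine strictAntiOn_of_deriv_neg (convex_Ici _) hg.continuous.continuousOn fun x hx ↦ ?_
    rw [interior_Ici] at hx
    exact hg' x (le_of_lt hx)
  have hχ₁m : StrictMonoOn χ₁ (Icc (θ₁ + ε) (θ₂ - ε)) := strictMonoOn_smoothStep h1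
  -- injectivity
  have key : ∀ s t, s < t → c s ≠ c t := by
    intro s t hst heq
    have hu : χ₁ s = χ₁ t := by rw [← hc0, ← hc0, heq]
    have hvst : v s = v t := by rw [← hc1, ← hc1, heq]
    by_cases hA : t ≤ θ₁ + ε
    · have := hfm (show s ∈ Iic (θ₁ + 2 * ε) by simp only [mem_Iic]; linarith)
        (show t ∈ Iic (θ₁ + 2 * ε) by simp only [mem_Iic]; linarith) hst
      rw [hvf s (by linarith), hvf t (by linarith)] at hvst
      exact this.ne hvst
    by_cases hB : θ₂ - ε ≤ s
    · have := hgm (show s ∈ Ici (θ₂ - 2 * ε) by simp only [mem_Ici]; linarith)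
        (show t ∈ Ici (θ₂ - 2 * ε) by simp only [mem_Ici]; linarith) hst
      rw [hvg s (by linarith), hvg t (by linarith)] at hvst
      exact this.ne' hvst
    push Not at hA hB
    have hs' : χ₁ s = χ₁ (max s (θ₁ + ε)) := by
      rcases le_total s (θ₁ + ε) with h | h
      · rw [max_eq_right h, hχ₁0 s h, hχ₁0 _ le_rfl]
      · rw [max_eq_left h]
    have ht' : χ₁ t = χ₁ (min t (θ₂ - ε)) := by
      rcases le_total t (θ₂ - ε) with h | h
      · rw [min_eq_left h]
      · rw [min_eq_right h, hχ₁1 t h, hχ₁1 _ le_rfl]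
    have hlt : max s (θ₁ + ε) < min t (θ₂ - ε) :=
      lt_min (max_lt hst hA) (max_lt hB h1)
    have := hχ₁m ⟨le_max_right _ _, (le_of_lt hlt).trans (min_le_right _ _)⟩
      ⟨(le_max_right _ _).trans (le_of_lt hlt), min_le_right _ _⟩ hlt
    rw [← hs', ← ht'] at this
    exact this.ne hu
  have hinj : Injective c := by
    intro s t hst
    rcases lt_trichotomy s t with h | h | h
    · exact absurd hst (key s t h)
    · exact h
    · exact absurd hst.symm (key t s h)
  -- regularity
  have hderiv : ∀ θ, HasDerivAt c (pt2 (deriv χ₁ θ) (deriv v θ)) θ := fun θ ↦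
    hasDerivAt_pt2 ((differentiable_smoothStep _ _ θ).hasDerivAt)
      ((hvs.differentiable (by simp) θ).hasDerivAt)
  have hreg : ∀ θ, deriv c θ ≠ 0 := by
    intro θ h0
    rw [(hderiv θ).deriv] at h0
    have hd0 : deriv χ₁ θ = 0 := by simpa using congrArg (fun w : EuclideanSpace ℝ (Fin 2) ↦ w 0) h0
    have hd1 : deriv v θ = 0 := by simpa using congrArg (fun w : EuclideanSpace ℝ (Fin 2) ↦ w 1) h0
    by_cases hA : θ < θ₁ + 2 * ε
    · have hev : v =ᶠ[𝓝 θ] f :=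
        Filter.eventuallyEq_of_mem (Iio_mem_nhds hA) fun y hy ↦ hvf y (le_of_lt hy)
      rw [hev.deriv_eq] at hd1
      exact (hf' θ (le_of_lt hA)).ne' hd1
    by_cases hB : θ₂ - 2 * ε < θ
    · have hev : v =ᶠ[𝓝 θ] g :=
        Filter.eventuallyEq_of_mem (Ioi_mem_nhds hB) fun y hy ↦ hvg y (le_of_lt hy)
      rw [hev.deriv_eq] at hd1
      exact (hg' θ (le_of_lt hB)).ne hd1
    push Not at hA hB
    exact (deriv_smoothStep_pos h1 ⟨by linarith, by linarith⟩).ne' hd0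
  refine ⟨hcs, hleft, hright, fun θ hθ' ↦ ?_, fun θ ↦ ?_, fun θ ↦ ?_, hinj, hreg⟩
  · rw [hc0]; exact smoothStep_mem_Ioo h1 hθ'
  · rw [hc0]; exact smoothStep_mem_Icc _ _ _
  · rw [hc1]
    exact combo_mem_uIcc (smoothStep_mem_Icc _ _ _).1 (smoothStep_mem_Icc _ _ _).2

/-- `exists_planarArch` with its witness named: the explicit arch is a witness. [folklore] -/
theorem exists_planarArch_eq (hε : 0 < ε) (hθ : θ₁ + 2 * ε < θ₂ - 2 * ε)
    (hf : ContDiff ℝ ∞ f) (hg : ContDiff ℝ ∞ g)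
    (hf' : ∀ θ, θ ≤ θ₁ + 2 * ε → 0 < deriv f θ)
    (hg' : ∀ θ, θ₂ - 2 * ε ≤ θ → deriv g θ < 0) :
    ∃ c : ℝ → EuclideanSpace ℝ (Fin 2), c = planarArch θ₁ θ₂ ε f g ∧ ContDiff ℝ ∞ c ∧
      (∀ θ, θ ≤ θ₁ + ε → c θ = pt2 0 (f θ)) ∧
      (∀ θ, θ₂ - ε ≤ θ → c θ = pt2 1 (g θ)) ∧
      (∀ θ ∈ Ioo (θ₁ + ε) (θ₂ - ε), c θ 0 ∈ Ioo (0 : ℝ) 1) ∧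
      (∀ θ, c θ 0 ∈ Icc (0 : ℝ) 1) ∧
      (∀ θ, c θ 1 ∈ uIcc (f θ) (g θ)) ∧
      Injective c ∧
      ∀ θ, deriv c θ ≠ 0 :=
  ⟨_, rfl, planarArch_spec hε hθ hf hg hf' hg'⟩

end PlanarArch

end Literature.Topology.FourManifolds
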